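import Summits.HodgeConjecture.HodgeConjecture.Theorems.VHCAbelianSchemesRoadPencilThroughDefs
import Literature.AlgebraicGeometry.HodgeTheory.SecantQuotientAnchorTwistedCarrier
import HarnessLib

/-!
# Road b02 (`VHCAbelianSchemesRoad`) — THE ONE FAMILY-SUPPLY HYPOTHESIS of the pencil-level C2 witness at Markman's secant anchors (definition only)

research route conditional on HC_CM; not a corollary; Q11.4-sentence-2 already refuted in dim ≥ 3.

DEFINITION ONLY (nothing asserted, nothing proved, `HC_CM` absent). By finding F2/F5 of the cell (ring2 LEAD gen 151, ring2-b02 g86, ring2-b03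
g76; director-hodge g7 2026-08-27): at Markman's secant-quotient anchor `Y_d = (X × X̂)/Ḡ` (`X = Pic²(C)`, `C` a GENERIC genus-3 curve, so the
Hodge ring of `X × X̂`, hence of `Y_d`, is generated by divisor classes) the served Weil class `γ` is algebraic-LEFSCHETZ, so the constant pencil
`Y_d × 𝔸¹` is OUTSIDE regime 2 of the cell `(6, 3)` of K-SR♭∃ and PART AA's constant-pencil criterion is silent there. The pencil-level «no
cosmetic split» witness INSIDE the cell's binders AND regime 2 therefore needs ONE family-supply input — the standard `Ring2.Hypotheses` kind
(a pointed Weil-type pencil through a given member), never a fact (ring2 LEAD gen 151 ruling, HOME INBOX 2026-08-27T04:39:58Z (2)/(3)) —, typed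
here MINIMALLY on exactly the data of the preprint fact `Literature.AlgebraicGeometry.HodgeTheory.HasSecantCarrierWeilAnchor` (ring2-b02's L1,
`SecantQuotientAnchorTwistedCarrier`) and the cell-shaped pencil set `exceptionalPencilClassesThrough` (ring2-b03, `VHCAbelianSchemesRoadPencilThroughDefs`):

* `SecantAnchorWeilPencilSupply` — for every `d > 0`, every polarised abelian sixfold `(Y, h)` receiving a morphism `q : P ⟶ Y` with `q^*`
  bijective on `H•(−; ℂ)` from a `ℚ(√-d)`-Weil sixfold `(P, ψ₀)` (`ψ₀² = -d`) that is HYPERBOLIC (split, discriminant `-1`) for `q^*h`, and every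
  rational class `γ ∉ ℂ·h³` on `Y` pulling back to a Weil class of `(P, ψ₀)`, the class `γ` is continued by a somewhere-exceptional fibrewise
  rational `(3,3)` class `W` along a CELL-SHAPED pencil through `(Y, h)` polarised by a global `Θ` (`γ ∈ exceptionalPencilClassesThrough 6 3 Y.X h`).
  In print: the connected `9`-dimensional family of polarised abelian sixfolds of split `ℚ(√-d)`-Weil type through `(P, ψ₀, q^*h)` (van Geemen
  1994, 5.3–5.5 and Lemma 5.2; Markman 2025 Cor. 1.3.2: the deformations of `(X × X̂, η, h)`), descended along the isogeny `q` (the finite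
  subgroup deforms flatly), restricted to a smooth affine curve through the anchor and a member of Néron–Severi rank one — where `B³ = D³ ⊕ W_K`
  and `W_K ∩ D³ = 0` (van Geemen Thm. 4.11), so the flat transport `W` of `γ` (fibrewise `(3,3)`: Markman Cor. 4.0.4) is exceptional there —,
  with the relative polarisation as `Θ` and the zero section of the universal family over a level cover. OPEN as a formal statement (no moduli
  space of Weil type in the tree); a HYPOTHESIS wherever used, displayed by the companion proof file `VHCAbelianSchemesRoadSecantAnchorInhabited`.

References: [cite: vanGeemen1994HodgeAV, Thm. 4.11, Lemma 5.2 and 5.3–5.5] [cite: Markman2025SecantWeil, Cor. 1.3.2, Thm. 1.4.1 and Cor. 4.0.4]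
[cite: Deligne1982HodgeCycles, §4, proof of Thm. 4.8 (a)–(c)] [cite: Mumford1969NoteShimura, §3].
-/

noncomputable section

open CategoryTheory CategoryTheory.Limits AlgebraicGeometry Topology

namespace Summit.HodgeConjecture.HodgeConjecture.Ring2.SemiregularRepresentatives

-- the cell's namespace repeats the summit name (`Summit.HodgeConjecture.HodgeConjecture…`), as in every `Ring2*` file
set_option linter.dupNamespace false

open Literature.AlgebraicGeometry Literature.AlgebraicGeometry.Motives
open Literature.AlgebraicGeometry.HodgeTheory
open Literature.AlgebraicTopology.SingularHomology

/-- **`SecantAnchorWeilPencilSupply` — the ONE family-supply hypothesis of the pencil-level C2 witness at the secant anchors** (typed missing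
input of the standard `Ring2.Hypotheses` kind; NOT a Literature fact; NOT a case of HC). For every `d > 0`, abelian sixfolds `P`, `Y`, `ψ₀ : P ⟶ P`
with `ψ₀ ≫ ψ₀ = -d`, `q : P ⟶ Y` with `q^*` bijective in every degree, a polarisation class `h` of `Y` with `(P, ψ₀)` hyperbolic Weil type for
`q^*h`, and a rational `γ ∉ ℂ·h³` on `Y` with `q^*γ` a Weil class of `(P, ψ₀)`: `γ ∈ exceptionalPencilClassesThrough 6 3 Y.X h` — there is a
one-parameter family of abelian sixfolds satisfying every binder of the cell `(6, 3)` of K-SR♭∃, through a fibre `≅ Y` polarised by the restriction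
`h` of a global fibrewise-rational `(1,1)` class `Θ`, carrying a global fibrewise-rational `(3,3)` class `W` restricting to `γ` there and NOT
algebraic-Lefschetz on every fibre. In print: the connected split-Weil moduli family through `(P, ψ₀, q^*h)` descended along `q`, cut to a curve
through a Néron–Severi-rank-one member (`B³ = D³ ⊕ W_K`, `W_K ∩ D³ = 0`), `W` the flat Weil section, `Θ` the relative polarisation, the zero
section over a level cover. OPEN as a formal statement; a HYPOTHESIS wherever used. [cite: vanGeemen1994HodgeAV, Thm. 4.11, Lemma 5.2 and 5.3–5.5]
[cite: Markman2025SecantWeil, Cor. 1.3.2 and Cor. 4.0.4] [cite: Deligne1982HodgeCycles, §4, proof of Thm. 4.8 (a)–(c)] [status: open] -/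
@[conjecture] def SecantAnchorWeilPencilSupply : Prop :=
  ∀ (d : ℕ) (P Y : AbelianVariety ℂ) (ψ₀ : P ⟶ P) (q : P ⟶ Y) (h : complexBetti Y.X 2) (γ : complexBetti Y.X (2 * 3)),
    0 < d → P.dim = 6 → Y.dim = 6 → ψ₀ ≫ ψ₀ = -(d • 𝟙 P) →
    (∀ k : ℕ, Function.Bijective (complexBetti.map q.hom.hom.hom k)) →
    IsPolarizationClass 6 Y.X h →
    IsHyperbolicWeilType P ψ₀ 3 (complexBetti.map q.hom.hom.hom 2 h) →
    IsRationalClass γ → γ ∉ (ℂ ∙ cupPowTwo h 3) →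
    complexBetti.map q.hom.hom.hom (2 * 3) γ ∈ weilClassesOf P ψ₀ 3 d →
    γ ∈ exceptionalPencilClassesThrough 6 3 Y.X h

/-! ## §2 The re-typed twin at C′ (appended, ring2-b03 gen 84)

The hypothesis `SecantAnchorWeilPencilSupply` above is FALSE AS TYPED (refute-markman gen 1, report `REFUTE-MARKMAN-G1.md` rev 2, class
refuted-misstated; kernel certificates `not_secantAnchorWeilPencilSupply_of_offType` and `isWeilType_of_secantAnchorWeilPencilSupply` /
`not_secantAnchorWeilPencilSupply_of_finrank_ne` under `Theorems/SemiregularSheafRepresentativesTwAtDiag/Negative/`): its binders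
`IsPolarizationClass` (NO positivity), `IsHyperbolicWeilType` (NO `ψ₀^*h = d·h`) and `weilClassesOf` (`⋀⁶V₊ ⊕ ⋀⁶V₋`, NO Weil-type balance) are
used outside the regime in which they force the served class `γ` to be of Hodge type `(3,3)`, whereas the conclusion forces `(3,3)` (iso
transport: `isOfHodgeType_of_mem_exceptionalPencilClassesThrough`); paper witness `E_ω⁶` with the diagonal `√-3`-action (K-multiplicities
`(6,0)`), an INDEFINITE hard-Lefschetz divisor class and a rational Weil class of type `(6,0)+(0,6)`. It stays above, byte-identical, as the
settled NEGATIVE EDGE. The repair ruled by director-hodge g9 (HOME INBOX 2026-08-27T15:31:15Z; LEAD 157's DOOR-PRIME-PACKAGE (iv)) is the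
refuter's MINIMAL one, C′: the same text with ONE added binder `IsOfHodgeType 6 Y.X (2 * 3) 3 3 γ` immediately before the conclusion — the
witness misses it (its `γ ≠ 0` is of type `(6,0)+(0,6)`), every consumer discharges it in one line (the served class is algebraic at the anchor,
`isOfHodgeType_of_mem_algebraicClasses_of_isSmoothProjective`; `IsSecantQuotientWeilClassAt.isOfHodgeType`), and under it a non-zero Weil class of
type `(3,3)` already forces van Geemen's Weil-type condition (balance), so the print-faithful C″ (`IsWeilType P ψ₀ 3 d`, `ψ₀^*(q^*h) = d•q^*h`,
`h` ample-induced) differs from C′ only in the positivity of `h` — load-bearing for the PRINT argument (van Geemen 5.3–5.5), see this lineage's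
`SUPPLY-REPAIR-NOTE-b03-g83.md` (Sylvester count `0 / 5 / 9` at `E⁶`); C′ is therefore «print for positive `h`, plausible (Weil-type product
sub-families) at the `B = D` points with indefinite hyperbolic `h`, true by constant pencils wherever `γ` is not Lefschetz on `Y`». -/

/-- **`SecantAnchorWeilPencilSupply'` — the family-supply hypothesis RE-TYPED AT C′** (the primed twin of the refuted-misstated
`SecantAnchorWeilPencilSupply`: verbatim the same binders plus `IsOfHodgeType 6 Y.X (2 * 3) 3 3 γ` before the conclusion; typed missing input
of the `Ring2.Hypotheses` kind; NOT a Literature fact; NOT a case of HC). For every `d > 0`, abelian sixfolds `P`, `Y`, `ψ₀ : P ⟶ P` with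
`ψ₀ ≫ ψ₀ = -d`, `q : P ⟶ Y` with `q^*` bijective in every degree, a polarisation class `h` of `Y` with `(P, ψ₀)` hyperbolic Weil type for `q^*h`,
and a rational `γ ∉ ℂ·h³` on `Y` OF HODGE TYPE `(3,3)` with `q^*γ` a Weil class of `(P, ψ₀)`: `γ ∈ exceptionalPencilClassesThrough 6 3 Y.X h` —
a one-parameter family of abelian sixfolds satisfying every binder of the cell `(6, 3)` of K-SR♭∃, through a fibre `≅ Y` polarised by the
restriction `h` of a global fibrewise-rational `(1,1)` class `Θ`, carrying a global fibrewise-rational `(3,3)` class `W` restricting to `γ` there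
and NOT algebraic-Lefschetz on every fibre. The refuter's off-type witness (`E_ω⁶`, `γ` of type `(6,0)+(0,6)`) misses the added binder; a
non-zero `(3,3)` Weil class forces `(P, ψ₀)` to be of Weil type, so what remains un-printed relative to van Geemen's family (5.3–5.5: `h`
from an ample class with `ψ₀^*h = d·h`) is only the positivity of `h`. In print (positive `h`): the connected split-Weil moduli family through
`(P, ψ₀, q^*h)` descended along `q`, cut to a curve through a Néron–Severi-rank-one member (`B³ = D³ ⊕ W_K`, `W_K ∩ D³ = 0`), `W` the flat Weil
section, `Θ` the relative polarisation, the zero section over a level cover. OPEN as a formal statement; a HYPOTHESIS wherever used, displayed by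
the companion proof file `VHCAbelianSchemesRoadSecantAnchorInhabitedPrime`. [cite: vanGeemen1994HodgeAV, Thm. 4.11, Lemma 5.2 and 5.3–5.5]
[cite: Markman2025SecantWeil, Cor. 1.3.2 and Cor. 4.0.4] [cite: Deligne1982HodgeCycles, §4, proof of Thm. 4.8 (a)–(c)] [status: open] -/
@[conjecture] def SecantAnchorWeilPencilSupply' : Prop :=
  ∀ (d : ℕ) (P Y : AbelianVariety ℂ) (ψ₀ : P ⟶ P) (q : P ⟶ Y) (h : complexBetti Y.X 2) (γ : complexBetti Y.X (2 * 3)),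
    0 < d → P.dim = 6 → Y.dim = 6 → ψ₀ ≫ ψ₀ = -(d • 𝟙 P) →
    (∀ k : ℕ, Function.Bijective (complexBetti.map q.hom.hom.hom k)) →
    IsPolarizationClass 6 Y.X h →
    IsHyperbolicWeilType P ψ₀ 3 (complexBetti.map q.hom.hom.hom 2 h) →
    IsRationalClass γ → γ ∉ (ℂ ∙ cupPowTwo h 3) →
    complexBetti.map q.hom.hom.hom (2 * 3) γ ∈ weilClassesOf P ψ₀ 3 d →
    IsOfHodgeType 6 Y.X (2 * 3) 3 3 γ →
    γ ∈ exceptionalPencilClassesThrough 6 3 Y.X h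

/-! ## §3 The twin RE-TYPED AT C″ (appended, ring2-b03 gen 86)

`SecantAnchorWeilPencilSupply'` (§2) is, in its turn, FALSE AS TYPED at paper level (refute-markman gen 2, report `REFUTE-MARKMAN-G2.md`
sha16 007f279b3d5d21ed, class refuted-misstated; ratified director-hodge g9 R10.3, 2026-08-27T18:50:36Z; Lean slice
`Theorems/SemiregularSheafRepresentativesTwPrimeAtDiag/Negative/SecantAnchorWeilPencilSupplyPrimeReducesToLefschetz.lean`, p556631): witness `d ≥ 2`,
`P = Y = J × Ĵ` for a genus-3 Jacobian with `End J = ℤ`, `q = 𝟙`, `ψ₀ = φ_d`, `h = pr₁^*θ + pr₂^*θ̂` the PRODUCT principal polarisation — ample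
and hyperbolic, but INCOMPATIBLE with `ψ₀` (`φ_d^*h = θ₁ + d²θ₂ ≠ d·h`) —, `γ` any non-zero rational Weil class: all binders of §2 hold, yet every
pencil through `(Y, h)` keeping `γ` and `h` Hodge has generic Mumford–Tate group `GSp(H¹J) ⊗ 1`, along which `γ` is a fixed rational cubic in flat
divisor classes, so `γ ∉ exceptionalPencilClassesThrough 6 3 Y.X h`. So §2's docstring sentence «what remains un-printed … is only the positivity
of `h`» is WRONG: positivity does not save §2 (the witness's `h` is ample); COMPATIBILITY does. The repair ruled (R10.3 (1)–(2)) is again the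
refuter's minimal one: `Supply″ := Supply′ +` the compatibility binder `ψ₀^*(q^*h) = d·(q^*h)` of van Geemen 5.3–5.5 (`E(kx, ky) = Nm(k)E(x, y)`),
which the witness misses and which the road's anchors satisfy BY THEOREM (at the pinned secant–quotient anchors `h = h_Y(θ)`:
`Literature.AlgebraicGeometry.Markman2025.complexBetti_map_descendedWeilOperator_secantPolarizationClass`, with the level factor `n²` absorbed in
`ψ_Y² = −n²d`). §1 and §2 stay above, byte-identical, as settled negative edges (paper-refuted hypotheses, not items; no stub consumes them);
consumers re-key to §3 (`…_of_supply''`: this lineage's companion file `VHCAbelianSchemesRoadSecantAnchorInhabitedPrimePrime`; lane W1's pinned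
chain by R10.3 (2) R2). -/

/-- **`SecantAnchorWeilPencilSupply''` — the family-supply hypothesis RE-TYPED AT C″** (the twin of the paper-refuted `SecantAnchorWeilPencilSupply'`:
verbatim the same binders plus the COMPATIBILITY of the polarisation with the Weil operator,
`complexBetti.map ψ₀ 2 (q^*h) = d • q^*h`, placed after the hyperbolicity binder; typed missing input of the `Ring2.Hypotheses` kind; NOT a
Literature fact; NOT a case of HC). For every `d > 0`, abelian sixfolds `P`, `Y`, `ψ₀ : P ⟶ P` with `ψ₀ ≫ ψ₀ = -d`, `q : P ⟶ Y` with `q^*`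
bijective in every degree, a polarisation class `h` of `Y` with `(P, ψ₀)` hyperbolic Weil type for `q^*h` AND `ψ₀^*(q^*h) = d·q^*h`, and a rational
`γ ∉ ℂ·h³` on `Y` of Hodge type `(3,3)` with `q^*γ` a Weil class of `(P, ψ₀)`: `γ ∈ exceptionalPencilClassesThrough 6 3 Y.X h` — a one-parameter
family of abelian sixfolds satisfying every binder of the cell `(6, 3)` of K-SR♭∃, through a fibre `≅ Y` polarised by the restriction `h` of a global
fibrewise-rational `(1,1)` class `Θ`, carrying a global fibrewise-rational `(3,3)` class `W` restricting to `γ` there and NOT algebraic-Lefschetz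
on every fibre. Under these binders `(P, ψ₀, q^*h)` is a POLARISED abelian sixfold of Weil type `(3, d)` in van Geemen's sense (type `(3,3)` forces
balance, `isWeilType_of_primedBinders`; compatibility is 5.2's `E(kx,ky) = Nm(k)E(x,y)`; `h` comes from an ample class by `IsPolarizationClass`),
so the print argument applies: the connected split-Weil moduli family through `(P, ψ₀, q^*h)` (5.3–5.5) descended along `q`, cut to a curve through
a Néron–Severi-rank-one member (`B³ = D³ ⊕ W_K`, `W_K ∩ D³ = 0`, Thm. 4.11), `W` the flat Weil section, `Θ` the relative polarisation, the zero
section over a level cover; refute-markman g2's witness (incompatible product polarisation) misses the new binder. OPEN as a formal statement (no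
moduli of Weil type in the tree); a HYPOTHESIS wherever used. [cite: vanGeemen1994HodgeAV, Thm. 4.11, Lemma 5.2 and 5.3–5.5]
[cite: Markman2025SecantWeil, Cor. 1.3.2, §3.2 Cor. 3.2.3 and Cor. 4.0.4] [cite: Deligne1982HodgeCycles, §4, proof of Thm. 4.8 (a)–(c)] [status: open] -/
@[conjecture] def SecantAnchorWeilPencilSupply'' : Prop :=
  ∀ (d : ℕ) (P Y : AbelianVariety ℂ) (ψ₀ : P ⟶ P) (q : P ⟶ Y) (h : complexBetti Y.X 2) (γ : complexBetti Y.X (2 * 3)),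
    0 < d → P.dim = 6 → Y.dim = 6 → ψ₀ ≫ ψ₀ = -(d • 𝟙 P) →
    (∀ k : ℕ, Function.Bijective (complexBetti.map q.hom.hom.hom k)) →
    IsPolarizationClass 6 Y.X h →
    IsHyperbolicWeilType P ψ₀ 3 (complexBetti.map q.hom.hom.hom 2 h) →
    complexBetti.map ψ₀.hom.hom.hom 2 (complexBetti.map q.hom.hom.hom 2 h) = (d : ℂ) • complexBetti.map q.hom.hom.hom 2 h →
    IsRationalClass γ → γ ∉ (ℂ ∙ cupPowTwo h 3) →
    complexBetti.map q.hom.hom.hom (2 * 3) γ ∈ weilClassesOf P ψ₀ 3 d →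
    IsOfHodgeType 6 Y.X (2 * 3) 3 3 γ →
    γ ∈ exceptionalPencilClassesThrough 6 3 Y.X h

end Summit.HodgeConjecture.HodgeConjecture.Ring2.SemiregularRepresentatives

end
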